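import Literature.NumberTheory.LFunctions.TruncatedWeilFormTailOrderPoleProofs
import Literature.NumberTheory.LFunctions.TruncatedWeilFormSourceSideProofs
import Literature.NumberTheory.ConnesConsani2025.ZetaSpectralTriplesInfraredProofs
import HarnessLib

/-!
# RH-FREE — «nothing here bears on the truth of RH»: the finite Guinand–Weil dictionary of Groskin 2026 (arXiv:2607.02828), §2 residuals — Lemma 2.1 (identification of `Q_∞` with the Connes–Consani–Moscovici Galerkin matrix) and Corollary 2.7 (pole-neutral source survival), typed AS PRINTED; the pole and prime blocks of the identification and the pole-square identity PROVED

Topic `Literature/NumberTheory/LFunctions` (namespace `Literature.NumberTheory.LFunctions`, the paper's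
objects in the sub-namespace `Groskin2026` as in the statement file
`TruncatedWeilFormTailOrder.lean`). STATEMENT LAYER (D-0014), cell `rh-columns/lit`, tranche 1
(unit `rh-lit-frontier-1`, gen 2: the residual §2 items that the first pass left untyped —
"Lemma 2.1 CCM-identification clause, Cor. 2.4, Cor. 2.7" — of which Cor. 2.4 (finite source quotient)
and the measure form of Lemma 2.3 are typed AND PROVED in the sibling
`TruncatedWeilFormSourceQuotient.lean`, and the dimension clause of Cor. 2.7 is PROVED in
`TruncatedWeilFormFiniteDictionaryProofs.lean`). Source:

* **[Gr26]** A. Groskin, *A finite Guinand–Weil dictionary and archimedean tail order for the truncated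
  Weil quadratic form*, arXiv:2607.02828v3 (14 Aug 2026). UNREFEREED (D-0012): every unproved printed
  statement is a `[claim: Groskin2026, status: under-review]`, consumed as a hypothesis, never asserted.
  Held: `paper:arxiv-2607.02828` (locators = printed pages). This file endorses nothing.
* **[CCM]** A. Connes, C. Consani, H. Moscovici, *Zeta spectral triples*, arXiv:2511.22755 = EMS Ser.
  Lect. Math. 37 (2026) — the tree's `Literature/NumberTheory/ConnesConsani2025/ZetaSpectralTriplesInfrared.lean`
  (§4–§5: `polarSharp`, `archSharp`, `primeSharp`, `weilDistribution`, `truncatedWeilMatrix`, `qKer`;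
  Lemma 4.1 PROVED there as `CCM2025_lemma_4_1_holds`). [Gr26] cites it as [10].

## What the source prints (p. 4, p. 7–8)

**Lemma 2.1 (Entry identification).** "The limit defining `Q_arch,∞` exists entrywise, and `Q_∞` is the
Connes–Consani–Moscovici Galerkin matrix of the Weil quadratic form: in the notation of [10, Eqs.
(3.10)–(3.11), (3.16)], `⟨v, Q_∞ v⟩ = W_{0,2}(F_v) − W_ℝ(F_v) − W_p(F_v)`, `F_v(x) = q(f_v, f_v)(log x)`,
where `f_v` is the trigonometric polynomial with coefficient vector `u` on the interval of length `L`. In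
particular `−Q_prime`, `Q_pole`, and `−Q_arch,∞` are the prime, pole, and archimedean blocks of the
Connes–Consani–Moscovici assembly." Proof, p. 4: "Each block is the divided-difference matrix of its
source in the sense of [11, Prop. 4.1]. For the prime block … the identification is definitional. For the
pole block, direct evaluation … gives `ψ₀(n) = C_c n/(n² + β²)` and `ψ₀′(n) = C_c(β² − n²)/(n² + β²)²` with
`β = L/(4π)` and `C_c = L(√c + 1/√c − 2)/(2π²)`, so that, using `16π² C_c = 32 L sinh²(L/4)`,
`(Q_pole)_{mn} = C_c (β² − mn)/((m² + β²)(n² + β²)) = 32L sinh²(L/4)(L² − 16π²mn)/((L² + 16π²m²)(L² + 16π²n²))`,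
which is the pole matrix of [10, Lemma 4.1] verbatim. For the archimedean block, `h₊` is the standard
archimedean density …; the entrywise `T`-limit exists because at integer nodes `S(r,n,L) = O(r⁻²)` …"

**Corollary 2.7 (Pole-neutral source survival)** (p. 7). "Let `β = L/(4π)` and, for `s ≥ 0`, put
`H_s(N) = {v : M₀(v) = M₂(v) = ⋯ = M_{2s}(v) = 0}`, where `M₀(v) = v₀ + √2 Σ_{k=1}^{N} v_k`,
`M_{2j}(v) = √2 Σ_{k=1}^{N} k^{2j} v_k` (`j ≥ 1`). Define the pole-neutral hyperplane
`P_N(c) = {v : v₀/β² + √2 Σ_{k=1}^{N} v_k/(k² + β²) = 0}`. If `N ≥ s + 2`, then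
`dim(H_s(N) ∩ P_N(c)) = N − s − 1 > 0`. Every nonzero vector in this space produces a nonzero test
function `g_v` with `g_v(i/2) = 0`, and `g_v = g_w` implies `v = w` or `v = −w`. On this family the
dictionary of Theorem 2.5 has no pole term." In the proof (p. 7): "`⟨v, Q_pole v⟩ =
C_c β² (v₀/β² + √2 Σ_{k=1}^{N} v_k/(k² + β²))² = 2 g_v(i/2)`", using "`Σ_m u_m m/(m² + β²) = 0` by symmetry".

## Lean rendering

* The CCM Galerkin matrix IS the tree's `ConnesConsani2025.truncatedWeilMatrix L N` ((5.1) of [CCM]: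
  `τ_{n,m} = D(q(U_n,U_m))`, `D = W♯_{0,2} − W♯_ℝ − Σ W♯_p` = `weilDistribution L = polarSharp L − archSharp L
  − primeSharp L`), on the same index type `Finset.Icc (−N) N = idx N` and with `L = log c`
  (`bandwidth`, `rho` of the statement file). So "`Q_∞` is the CCM Galerkin matrix" is the matrix identity
  `cutoffFreeMatrix c N = truncatedWeilMatrix (log c) N`, and the three block statements are
  `Q_pole(m,n) = polarSharp L (qKer L m n)`, `Q_prime(m,n) = −primeSharp L (qKer L m n)`,
  `Q_arch,∞(m,n) = −archSharp L (qKer L m n)`.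
* The pole block and the prime block are PROVED (`poleMatrix_eq_polarSharp` — from the statement file's
  claim `lemma_2_1_pole`, now the tree theorem `lemma_2_1_pole_holds`, and [CCM] Lemma 4.1 =
  `CCM2025_lemma_4_1_holds`; `primeMatrix_eq_neg_primeSharp` — "definitional": both sides are the same
  finite von Mangoldt sum once `sin(2πm(1 − y/L)) = −sin(2πmy/L)` at integer `m`). The archimedean block is
  the one analytic statement left: CLAIM `lemma_2_1_arch` (stated with `Tendsto`, so that it also carries
  the first clause "the limit exists", the statement file's `lemma_2_1_limit`); from it the identification
  `cutoffFreeMatrix_eq_truncatedWeilMatrix` is PROVED, and `lemma_2_1_arch_iff` records that the claim is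
  EQUIVALENT to (`lemma_2_1_limit` ∧ the identification).
* Cor. 2.7: `poleBeta c = β`, `poleConst c = C_c`; the even-sector weights `evenWeight k = ε_k` (`ε₀ = 1`,
  `ε_k = √2` for `k ≥ 1`, the isometry `u₀ = v₀`, `u_{±k} = v_k/√2` of `evenEmbed`); `evenMoment N j v =
  Σ_{k=0}^{N} ε_k k^{2j} v_k` (= the printed `M_{2j}(v)`: `evenMoment_zero`, `evenMoment_of_ne_zero`),
  `momentNeutral N s = H_s(N)` (a `Submodule`), `poleRow c N v = Σ_k ε_k v_k/(k² + β²)` (= the printed row,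
  `poleRow_eq`), `poleNeutral c N = P_N(c)`; the corollary is the CLAIM `corollary_2_7` (dimension via
  `Module.finrank`; `g_v = testFunction c N v`; the injectivity clause for all real `v, w`, which is what
  the printed proof — the Volterra algebra of germs is an integral domain — establishes).

## Proved here (cheap kernel consequences)

`poleMatrix_eq_polarSharp`, `primeMatrix_eq_neg_primeSharp` (two of the three blocks of Lemma 2.1),
`archMatrixInfty_eq_of_arch`, `lemma_2_1_limit_of_arch`, `cutoffFreeMatrix_eq_truncatedWeilMatrix`,
`lemma_2_1_arch_iff`; `poleConst_eq` (`√c + 1/√c − 2 = 4 sinh²(L/4)`, so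
`16π² C_c = 32 L sinh²(L/4)`), `poleConst_pos`, `poleSource_intCast_eq_poleConst` (`ψ₀(n) = C_c n/(n² + β²)`),
`deriv_poleSource_intCast` (`ψ₀′(n) = C_c(β² − n²)/(n² + β²)²`), `poleMatrix_eq_poleConst`,
`quadValue_poleMatrix_eq_sq` (the displayed `⟨v, Q_pole v⟩ = C_c β² (v₀/β² + √2 Σ v_k/(k² + β²))²`, with the
symmetry step `sum_evenEmbed_mul_div`), `quadValue_poleMatrix_eq_zero_of_mem_poleNeutral`, and — with
the pole side of Theorem 2.5 `⟨v, Q_pole v⟩ = 2g_v(i/2)` PROVED meanwhile by seat rh-crit-cc-t9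
(`quadValue_poleMatrix`, `TruncatedWeilFormSourceSideProofs.lean`, imported by name) —
`two_mul_testFunction_I_half_eq_sq`, `testFunction_I_half_eq_zero_of_mem_poleNeutral` (Cor. 2.7 (b):
"`g_v(i/2) = 0`" on the family, "the dictionary has no pole term"),
`mem_poleNeutral_iff_testFunction_I_half_eq_zero`; bookkeeping for sums over `I_N` (`negIdx`,
`sum_idx_eq_zero_of_odd`, `sum_idx_split`, `sum_evenEmbed_mul_even`).

## Status note (one paragraph, no endorsement)

[Gr26] is an unrefereed arXiv preprint (v3, 14 Aug 2026). Of its Lemma 2.1, the pole and prime blocks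
of the identification with the [CCM] matrix are finite identities and are kernel theorems here; the
archimedean block (equality of the `T → ∞` limit of the finite-cutoff source matrix with [CCM]'s `W♯_ℝ`
block in the form (4.4)) is an exchange-of-limits / distributional-Fourier statement about
`h₊(r) = Re ψ(¼ + ir/2) − log π` against the kernels `sin(2πny/L)`, `(1 − y/L)cos(2πny/L)` and is
recorded as the claim `lemma_2_1_arch` (the paper's own numerical cross-check: agreement "to
`2.0·10⁻¹⁰` at `(c,N) = (29,6)` and to `2.1·10⁻¹⁵` at `(13,4)`", p. 4). Corollary 2.7 is typed with its
three clauses as one claim; its displayed pole-square identity is proved from the (proved) closed form of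
`Q_pole`, and `g_v(i/2) = 0` on `P_N(c)` follows with the (proved) pole side of Theorem 2.5; the dimension
count (the Vandermonde-type independence argument of p. 8) is proved in the companion
`TruncatedWeilFormFiniteDictionaryProofs.lean` (`finrank_momentNeutral_inf_poleNeutral`, `corollary_2_7_dim`);
`g_v ≠ 0` for `v ≠ 0` and the injectivity `g_v = g_w ⇒ v = ±w` (Volterra integral-domain argument) are not
proved in the tree. Corollary 2.4 (finite source quotient) and the measure form of Lemma 2.3 are typed and
proved in `TruncatedWeilFormSourceQuotient.lean`; the numerical §§2.3, 4 are not typed.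
Nothing here bears on Weil positivity or on the truth of RH.
-/

noncomputable section

open Filter Set MeasureTheory Finset Matrix
open scoped Real Topology

namespace Literature.NumberTheory.LFunctions

namespace Groskin2026

open Literature.NumberTheory.ConnesConsani2025 (qKer polarSharp archSharp primeSharp weilDistribution
  truncatedWeilMatrix CCM2025_lemma_4_1_holds qKer_of_ne qKer_self)

/-! ## Lemma 2.1, second clause: `Q_∞` is the Connes–Consani–Moscovici Galerkin matrix -/

/-- **[Gr26] Lemma 2.1, pole block — PROVED:** `(Q_pole)_{mn}` is the polar block `W♯_{0,2}(q(U_m,U_n)∘log)`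
of the [CCM] assembly ("which is the pole matrix of [10, Lemma 4.1] verbatim", p. 4): both are
`32 L sinh²(L/4)(L² − 16π²mn)/((L² + 16π²m²)(L² + 16π²n²))` (`lemma_2_1_pole_holds`, `CCM2025_lemma_4_1_holds`).
[cite: Groskin2026, Lemma 2.1, proof (p. 4)] -/
theorem poleMatrix_eq_polarSharp {c : ℝ} (hc : 1 < c) (N : ℕ) (m n : idx N) :
    poleMatrix c N m n = polarSharp (Real.log c) (qKer (Real.log c) m n) := by
  rw [lemma_2_1_pole_holds c hc N m n,
    CCM2025_lemma_4_1_holds (Real.log c) (Real.log_pos hc) (m : ℤ) (n : ℤ)]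
  ring

/-- `sin(2πm(1 − t)) = −sin(2πmt)` for an integer `m`. [folklore] -/
private theorem sin_two_pi_intCast_mul_one_sub (m : ℤ) (t : ℝ) :
    Real.sin (2 * π * m * (1 - t)) = -Real.sin (2 * π * m * t) := by
  rw [show 2 * π * m * (1 - t) = -(2 * π * m * t) + (m : ℤ) * (2 * π) by ring,
    Real.sin_add_int_mul_two_pi, Real.sin_neg]

/-- `cos(2πm(1 − t)) = cos(2πmt)` for an integer `m`. [folklore] -/
private theorem cos_two_pi_intCast_mul_one_sub (m : ℤ) (t : ℝ) :
    Real.cos (2 * π * m * (1 - t)) = Real.cos (2 * π * m * t) := by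
  rw [show 2 * π * m * (1 - t) = -(2 * π * m * t) + (m : ℤ) * (2 * π) by ring,
    Real.cos_add_int_mul_two_pi, Real.cos_neg]

/-- The von Mangoldt sum of the prime source (over `0 ≤ q ≤ ⌊c⌋` with `q^{-1/2} = 1/√q`) is the sum of
[CCM] (4.3) (over `2 ≤ k ≤ ⌊e^{L}⌋`, `L = log c`, with `k^{-1/2}` as an `rpow`): the terms `q = 0, 1`
vanish. [cite: Groskin2026, §2.1 eq. (1) (p. 3)] -/
theorem sum_range_vonMangoldt_eq {c : ℝ} (hc : 1 < c) (g : ℕ → ℝ) :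
    ∑ q ∈ Finset.range (⌊c⌋₊ + 1), (ArithmeticFunction.vonMangoldt q) / Real.sqrt q * g q =
      ∑ k ∈ Finset.Icc 2 ⌊Real.exp (Real.log c)⌋₊,
        ArithmeticFunction.vonMangoldt k * (k : ℝ) ^ (-(1 / 2 : ℝ)) * g k := by
  rw [Real.exp_log (by linarith)]
  have hsub : Finset.Icc 2 ⌊c⌋₊ ⊆ Finset.range (⌊c⌋₊ + 1) := by
    intro k hk
    rw [Finset.mem_Icc] at hk
    rw [Finset.mem_range]; omega
  rw [← Finset.sum_subset hsub]
  · refine Finset.sum_congr rfl fun k _ ↦ ?_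
    rw [Real.sqrt_eq_rpow, Real.rpow_neg (Nat.cast_nonneg k), div_eq_mul_inv]
  · intro k hk hk2
    rw [Finset.mem_range] at hk
    rw [Finset.mem_Icc, not_and_or, not_le, not_le] at hk2
    have : k = 0 ∨ k = 1 := by omega
    rcases this with rfl | rfl
    · simp
    · simp [ArithmeticFunction.vonMangoldt_apply_one]

/-- The prime source at an integer node: `ψ_p(m) = (1/π) Σ_{2 ≤ k ≤ c} Λ(k) k^{-1/2} sin(2πm log k/L)`.
[cite: Groskin2026, §2.1 eq. (1) and proof of Lemma 2.1 (p. 3–4)] -/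
theorem primeSource_intCast {c : ℝ} (hc : 1 < c) (m : ℤ) :
    primeSource c m = (1 / π) * ∑ k ∈ Finset.Icc 2 ⌊Real.exp (Real.log c)⌋₊,
      ArithmeticFunction.vonMangoldt k * (k : ℝ) ^ (-(1 / 2 : ℝ)) *
        Real.sin (2 * π * m * Real.log k / Real.log c) := by
  unfold primeSource
  rw [← sum_range_vonMangoldt_eq hc, neg_mul, ← mul_neg, ← Finset.sum_neg_distrib]
  congr 1
  refine Finset.sum_congr rfl fun q _ ↦ ?_
  rw [sin_two_pi_intCast_mul_one_sub]
  rw [show 2 * π * (m : ℝ) * (Real.log q / Real.log c) = 2 * π * m * Real.log q / Real.log c by ring]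
  ring

/-- The derivative of the prime source at an integer node:
`ψ_p′(m) = −Σ_{2 ≤ k ≤ c} Λ(k) k^{-1/2} · 2(1 − log k/L) cos(2πm log k/L)`.
[cite: Groskin2026, §2.1 eq. (1) and proof of Lemma 2.1 (p. 3–4)] -/
theorem hasDerivAt_primeSource_intCast {c : ℝ} (hc : 1 < c) (m : ℤ) :
    HasDerivAt (primeSource c)
      (-∑ k ∈ Finset.Icc 2 ⌊Real.exp (Real.log c)⌋₊,
        ArithmeticFunction.vonMangoldt k * (k : ℝ) ^ (-(1 / 2 : ℝ)) *
          (2 * (1 - Real.log k / Real.log c) * Real.cos (2 * π * m * Real.log k / Real.log c))) m := by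
  have hterm : ∀ q : ℕ, HasDerivAt
      (fun x : ℝ ↦ (ArithmeticFunction.vonMangoldt q) / Real.sqrt q *
        Real.sin (2 * π * x * (1 - Real.log q / Real.log c)))
      ((ArithmeticFunction.vonMangoldt q) / Real.sqrt q *
        (Real.cos (2 * π * m * (1 - Real.log q / Real.log c)) *
          (2 * π * (1 - Real.log q / Real.log c)))) m := by
    intro q
    have hlin : HasDerivAt (fun x : ℝ ↦ 2 * π * x * (1 - Real.log q / Real.log c))
        (2 * π * (1 - Real.log q / Real.log c)) m := by
      have := ((hasDerivAt_id (m : ℝ)).const_mul (2 * π)).mul_const (1 - Real.log q / Real.log c)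
      simpa using this
    exact ((Real.hasDerivAt_sin _).comp (m : ℝ) hlin).const_mul _
  have hsum := (HasDerivAt.fun_sum fun q (_ : q ∈ Finset.range (⌊c⌋₊ + 1)) ↦ hterm q).const_mul
    (-(1 / π))
  have hfun : primeSource c = fun x ↦ -(1 / π) * ∑ q ∈ Finset.range (⌊c⌋₊ + 1),
      (ArithmeticFunction.vonMangoldt q) / Real.sqrt q *
        Real.sin (2 * π * x * (1 - Real.log q / Real.log c)) := by
    funext x; simp only [primeSource]
  rw [hfun]
  refine hsum.congr_deriv ?_
  rw [← sum_range_vonMangoldt_eq hc (fun k ↦ 2 * (1 - Real.log k / Real.log c) *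
      Real.cos (2 * π * m * Real.log k / Real.log c)), neg_mul, Finset.mul_sum,
    ← Finset.sum_neg_distrib, ← Finset.sum_neg_distrib]
  refine Finset.sum_congr rfl fun q _ ↦ ?_
  rw [cos_two_pi_intCast_mul_one_sub,
    show 2 * π * (m : ℝ) * (Real.log q / Real.log c) = 2 * π * m * Real.log q / Real.log c by ring]
  have hπ : (π : ℝ) ≠ 0 := Real.pi_ne_zero
  field_simp

/-- **[Gr26] Lemma 2.1, prime block — PROVED:** `(Q_prime)_{mn} = −Σ_p W♯_p(q(U_m,U_n)∘log)`, i.e. `−Q_prime`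
is the prime block of the [CCM] assembly ("the identification is definitional", p. 4): off the diagonal
both sides are `Σ_k Λ(k)k^{-1/2}(sin(2πm log k/L) − sin(2πn log k/L))/(π(m − n))`, on the diagonal
`−Σ_k Λ(k)k^{-1/2} 2(1 − log k/L)cos(2πm log k/L)` ([CCM] (2.8)/(2.10) = `qKer_of_ne`/`qKer_self`).
[cite: Groskin2026, Lemma 2.1, proof (p. 4)] -/
theorem primeMatrix_eq_neg_primeSharp {c : ℝ} (hc : 1 < c) (N : ℕ) (m n : idx N) :
    primeMatrix c N m n = -primeSharp (Real.log c) (qKer (Real.log c) m n) := by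
  have hL : 0 < Real.log c := Real.log_pos hc
  have hc0 : 0 < c := by linarith
  have hmem : ∀ k ∈ Finset.Icc 2 ⌊Real.exp (Real.log c)⌋₊, Real.log k ∈ Icc 0 (Real.log c) := by
    intro k hk
    rw [Finset.mem_Icc, Real.exp_log hc0] at hk
    have hk2 : (2 : ℝ) ≤ k := by exact_mod_cast hk.1
    refine ⟨Real.log_nonneg (by linarith), Real.log_le_log (by linarith) ?_⟩
    exact (Nat.cast_le.mpr hk.2).trans (Nat.floor_le hc0.le)
  unfold primeMatrix dividedDiffMatrix
  rw [Matrix.of_apply]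
  split_ifs with h
  · -- diagonal entry: `ψ_p′(m)`
    have hmn : n = m := Subtype.ext h.symm
    subst hmn
    rw [(hasDerivAt_primeSource_intCast hc (n : ℤ)).deriv, primeSharp, ← Finset.sum_neg_distrib,
      ← Finset.sum_neg_distrib]
    refine Finset.sum_congr rfl fun k hk ↦ ?_
    rw [qKer_self hL (n : ℤ) (hmem k hk)]
  · -- off-diagonal entry: divided difference of the integer values
    have hmn : ((m : ℤ) : ℝ) - ((n : ℤ) : ℝ) ≠ 0 := by
      rw [sub_ne_zero]; exact_mod_cast h
    rw [primeSource_intCast hc, primeSource_intCast hc, primeSharp, ← Finset.sum_neg_distrib]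
    have hq : ∀ k ∈ Finset.Icc 2 ⌊Real.exp (Real.log c)⌋₊,
        -(ArithmeticFunction.vonMangoldt k * (k : ℝ) ^ (-(1 / 2 : ℝ)) *
            qKer (Real.log c) m n (Real.log k)) =
          ArithmeticFunction.vonMangoldt k * (k : ℝ) ^ (-(1 / 2 : ℝ)) *
            ((Real.sin (2 * π * m * Real.log k / Real.log c) -
                Real.sin (2 * π * n * Real.log k / Real.log c)) / (π * ((m : ℤ) - (n : ℤ) : ℝ))) := by
      intro k hk
      rw [qKer_of_ne hL (by exact_mod_cast h) (hmem k hk)]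
      have hπ : (π : ℝ) * (((m : ℤ) : ℝ) - ((n : ℤ) : ℝ)) ≠ 0 := mul_ne_zero Real.pi_ne_zero hmn
      field_simp
      ring
    rw [Finset.sum_congr rfl hq, ← mul_sub, ← Finset.sum_sub_distrib, Finset.mul_sum, Finset.sum_div]
    refine Finset.sum_congr rfl fun k _ ↦ ?_
    have hπ : (π : ℝ) ≠ 0 := Real.pi_ne_zero
    field_simp

/-- **[Gr26] Lemma 2.1, archimedean block — CLAIM:** `−Q_arch,∞` is the archimedean block `W♯_ℝ` of the
[CCM] assembly ([CCM] (3.15)/(4.4), the tree's `archSharp`): for every `c > 1`, `N`, `m, n ∈ I_N`,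
`(Q_arch,T)_{mn} → −W♯_ℝ(q(U_m,U_n)∘log)` as `T → ∞` (stated with `Tendsto`, so it contains the first
clause "the limit defining `Q_arch,∞` exists entrywise" = `lemma_2_1_limit`; printed reason: "the
entrywise `T`-limit exists because at integer nodes `S(r,n,L) = O(r⁻²)` and `∂ₓS(r,x,L)|_{x=n} = O(r⁻²)`
uniformly on `I_N` … while `h₊(r) = O(log r)`", and `h₊` "is the standard archimedean density of the
explicit formula … the density of `W_ℝ` in [10, Sec. 3]"). This is the one analytic clause of the
identification; the pole and prime blocks are the theorems above. CLAIM.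
[claim: Groskin2026, status: under-review] -/
def lemma_2_1_arch : Prop :=
  ∀ (c : ℝ), 1 < c → ∀ (N : ℕ) (m n : idx N),
    Tendsto (fun T : ℝ ↦ archMatrix c N T m n) atTop
      (𝓝 (-archSharp (Real.log c) (qKer (Real.log c) m n)))

/-- Under the archimedean clause, `Q_arch,∞ = −W♯_ℝ`-block entrywise (the `limUnder` in `archMatrixInfty`
is then junk-free). PROVED from the claim. [cite: Groskin2026, Lemma 2.1 (p. 4)] -/
theorem archMatrixInfty_eq_of_arch (h : lemma_2_1_arch) {c : ℝ} (hc : 1 < c) (N : ℕ) (m n : idx N) :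
    archMatrixInfty c N m n = -archSharp (Real.log c) (qKer (Real.log c) m n) := by
  unfold archMatrixInfty
  rw [Matrix.of_apply]
  exact (h c hc N m n).limUnder_eq

/-- The archimedean clause implies the first clause of Lemma 2.1 as typed in the statement file
(`lemma_2_1_limit`: the entrywise limit exists and is `archMatrixInfty`). PROVED.
[cite: Groskin2026, Lemma 2.1 (p. 4)] -/
theorem lemma_2_1_limit_of_arch (h : lemma_2_1_arch) : lemma_2_1_limit := by
  intro c hc N m n
  rw [archMatrixInfty_eq_of_arch h hc]
  exact h c hc N m n

/-- **[Gr26] Lemma 2.1, second clause** ("`Q_∞` is the Connes–Consani–Moscovici Galerkin matrix of the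
Weil quadratic form"), PROVED from the archimedean clause: `Q_∞ = Q_prime + Q_pole + Q_arch,∞` equals
the tree's [CCM] (5.1) matrix `τ = (D(q(U_m,U_n)))_{m,n ∈ I_N}`, `D = W♯_{0,2} − W♯_ℝ − Σ_p W♯_p`, at
`L = log c`. [cite: Groskin2026, Lemma 2.1 (p. 4)] -/
theorem cutoffFreeMatrix_eq_truncatedWeilMatrix (h : lemma_2_1_arch) {c : ℝ} (hc : 1 < c) (N : ℕ) :
    cutoffFreeMatrix c N = truncatedWeilMatrix (Real.log c) N := by
  ext m n
  rw [cutoffFreeMatrix, Matrix.add_apply, Matrix.add_apply, primeMatrix_eq_neg_primeSharp hc,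
    poleMatrix_eq_polarSharp hc, archMatrixInfty_eq_of_arch h hc, truncatedWeilMatrix, Matrix.of_apply,
    weilDistribution]
  ring

/-- Bookkeeping: given the proved pole and prime blocks, the archimedean claim `lemma_2_1_arch` is
EQUIVALENT to the conjunction of the two printed clauses of Lemma 2.1 as typed (`lemma_2_1_limit` ∧
`Q_∞ = τ`). PROVED. [cite: Groskin2026, Lemma 2.1 (p. 4)] -/
theorem lemma_2_1_arch_iff :
    lemma_2_1_arch ↔ lemma_2_1_limit ∧
      ∀ (c : ℝ), 1 < c → ∀ N : ℕ, cutoffFreeMatrix c N = truncatedWeilMatrix (Real.log c) N := by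
  constructor
  · exact fun h ↦ ⟨lemma_2_1_limit_of_arch h, fun c hc N ↦ cutoffFreeMatrix_eq_truncatedWeilMatrix h hc N⟩
  · rintro ⟨hlim, hid⟩ c hc N m n
    have key : archMatrixInfty c N m n = -archSharp (Real.log c) (qKer (Real.log c) m n) := by
      have e := congrFun (congrFun (hid c hc N) m) n
      rw [cutoffFreeMatrix, Matrix.add_apply, Matrix.add_apply, primeMatrix_eq_neg_primeSharp hc,
        poleMatrix_eq_polarSharp hc, truncatedWeilMatrix, Matrix.of_apply, weilDistribution] at e
      linarith
    rw [← key]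
    exact hlim c hc N m n

/-! ## Corollary 2.7: the pole-neutral family -/

/-- `β = L/(4π)`, `L = log c` ([Gr26] Cor. 2.7). [cite: Groskin2026, Corollary 2.7 (p. 7)] -/
def poleBeta (c : ℝ) : ℝ := Real.log c / (4 * π)

/-- `C_c = L(√c + 1/√c − 2)/(2π²) > 0` ([Gr26] proof of Cor. 2.7 / of Lemma 2.1).
[cite: Groskin2026, Corollary 2.7, proof (p. 7)] -/
def poleConst (c : ℝ) : ℝ := Real.log c * (Real.sqrt c + 1 / Real.sqrt c - 2) / (2 * π ^ 2)

/-- `√c + 1/√c − 2 = 4 sinh²(log c/4)` (`c > 0`). [folklore] -/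
private theorem sqrt_add_inv_sqrt_sub_two {c : ℝ} (hc : 0 < c) :
    Real.sqrt c + 1 / Real.sqrt c - 2 = 4 * Real.sinh (Real.log c / 4) ^ 2 := by
  set E : ℝ := Real.exp (Real.log c / 4) with hE
  have hE0 : E ≠ 0 := (Real.exp_pos _).ne'
  have hsqrt : Real.sqrt c = E ^ 2 := by
    rw [hE, pow_two, ← Real.exp_add, Real.sqrt_eq_rpow, Real.rpow_def_of_pos hc]
    congr 1; ring
  have hsinh : Real.sinh (Real.log c / 4) = (E - E⁻¹) / 2 := by
    rw [Real.sinh_eq, hE, Real.exp_neg]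
  rw [hsqrt, hsinh]
  field_simp
  ring

/-- "`16π² C_c = 8L(√c + 1/√c − 2) = 32 L sinh²(L/4)`" (p. 4): `C_c = 2L sinh²(L/4)/π²`. PROVED.
[cite: Groskin2026, Lemma 2.1, proof (p. 4)] -/
theorem poleConst_eq {c : ℝ} (hc : 1 < c) :
    poleConst c = 2 * Real.log c * Real.sinh (Real.log c / 4) ^ 2 / π ^ 2 := by
  unfold poleConst
  rw [sqrt_add_inv_sqrt_sub_two (by linarith)]
  ring

/-- `C_c > 0` for `c > 1` (p. 7). PROVED. [cite: Groskin2026, Corollary 2.7, proof (p. 7)] -/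
theorem poleConst_pos {c : ℝ} (hc : 1 < c) : 0 < poleConst c := by
  rw [poleConst_eq hc]
  have hL : 0 < Real.log c := Real.log_pos hc
  have hs : 0 < Real.sinh (Real.log c / 4) := Real.sinh_pos_iff.mpr (by positivity)
  positivity

/-- `β > 0` for `c > 1`. [cite: Groskin2026, Corollary 2.7 (p. 7)] -/
theorem poleBeta_pos {c : ℝ} (hc : 1 < c) : 0 < poleBeta c := by
  have hL : 0 < Real.log c := Real.log_pos hc
  unfold poleBeta; positivity

/-- "Direct evaluation of the pole source (2) at integer frequencies … gives `ψ₀(n) = C_c n/(n² + β²)`"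
(p. 7). PROVED (from `poleSource_intCast`). [cite: Groskin2026, Corollary 2.7, proof (p. 7)] -/
theorem poleSource_intCast_eq_poleConst {c : ℝ} (hc : 1 < c) (n : ℤ) :
    poleSource c n = poleConst c * n / ((n : ℝ) ^ 2 + poleBeta c ^ 2) := by
  have hL : 0 < Real.log c := Real.log_pos hc
  rw [poleSource_intCast hc, poleConst_eq hc]
  unfold poleBeta
  have hπ : (π : ℝ) ≠ 0 := Real.pi_ne_zero
  have hD : ((n : ℝ) ^ 2 + (Real.log c / (4 * π)) ^ 2) ≠ 0 := by positivity
  have hD' : (Real.log c ^ 2 + 16 * π ^ 2 * (n : ℝ) ^ 2) ≠ 0 := by positivity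
  field_simp
  ring

/-- "… and of its `x`-derivative at integer frequencies, gives `ψ₀′(n) = C_c(β² − n²)/(n² + β²)²`" (p. 7;
"Both evaluations are needed: … the diagonal entries are `ψ₀′(n)`, and value agreement at integers alone
would not determine them"). PROVED (from `poleSource_eq_closedForm`, `hasDerivAt_poleClosedForm_intCast`).
[cite: Groskin2026, Corollary 2.7, proof (p. 7)] -/
theorem deriv_poleSource_intCast {c : ℝ} (hc : 1 < c) (n : ℤ) :
    deriv (poleSource c) n =
      poleConst c * (poleBeta c ^ 2 - (n : ℝ) ^ 2) / ((n : ℝ) ^ 2 + poleBeta c ^ 2) ^ 2 := by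
  have hL : 0 < Real.log c := Real.log_pos hc
  have hfun : poleSource c = fun x : ℝ ↦
      16 * x * Real.log c * (Real.cosh (Real.log c / 2) - Real.cos (2 * π * x)) /
        (Real.log c ^ 2 + 16 * π ^ 2 * x ^ 2) := funext (poleSource_eq_closedForm hc)
  rw [hfun, (hasDerivAt_poleClosedForm_intCast hL n).deriv, poleConst_eq hc]
  unfold poleBeta
  have hπ : (π : ℝ) ≠ 0 := Real.pi_ne_zero
  have hD : ((n : ℝ) ^ 2 + (Real.log c / (4 * π)) ^ 2) ≠ 0 := by positivity
  have hD' : (Real.log c ^ 2 + 16 * π ^ 2 * (n : ℝ) ^ 2) ≠ 0 := by positivity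
  field_simp
  ring

/-- "`Q_pole` is exactly `C_c` times the divided-difference matrix of `f(x) = x/(x² + β²)`, including the
diagonal `f′(n)`": `(Q_pole)_{mn} = C_c(β² − mn)/((m² + β²)(n² + β²))` "with the `m = n` limit `f′(m)`"
(p. 7). PROVED (from `lemma_2_1_pole_holds`). [cite: Groskin2026, Corollary 2.7, proof (p. 7)] -/
theorem poleMatrix_eq_poleConst {c : ℝ} (hc : 1 < c) (N : ℕ) (m n : idx N) :
    poleMatrix c N m n =
      poleConst c * (poleBeta c ^ 2 - ((m : ℤ) : ℝ) * ((n : ℤ) : ℝ)) /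
        ((((m : ℤ) : ℝ) ^ 2 + poleBeta c ^ 2) * (((n : ℤ) : ℝ) ^ 2 + poleBeta c ^ 2)) := by
  have hL : 0 < Real.log c := Real.log_pos hc
  rw [lemma_2_1_pole_holds c hc N m n, poleConst_eq hc]
  unfold poleBeta
  have hπ : (π : ℝ) ≠ 0 := Real.pi_ne_zero
  have hDm : (((m : ℤ) : ℝ) ^ 2 + (Real.log c / (4 * π)) ^ 2) ≠ 0 := by positivity
  have hDn : (((n : ℤ) : ℝ) ^ 2 + (Real.log c / (4 * π)) ^ 2) ≠ 0 := by positivity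
  have hDm' : (Real.log c ^ 2 + 16 * π ^ 2 * ((m : ℤ) : ℝ) ^ 2) ≠ 0 := by positivity
  have hDn' : (Real.log c ^ 2 + 16 * π ^ 2 * ((n : ℤ) : ℝ) ^ 2) ≠ 0 := by positivity
  field_simp
  ring

/-- The even-sector weights `ε₀ = 1`, `ε_k = √2` (`k ≥ 1`): for the isometric embedding `u₀ = v₀`,
`u_{±k} = v_k/√2` of §2.1 one has `Σ_{m ∈ I_N} u_m g(m) = Σ_{k=0}^{N} ε_k v_k g(k)` for every even `g`
(`sum_evenEmbed_mul_even`); this is where the coefficients `1, √2` of `M_{2j}` and of `P_N(c)` come from.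
[cite: Groskin2026, §2.1 (p. 3) and Corollary 2.7 (p. 7)] -/
def evenWeight (k : ℕ) : ℝ := if k = 0 then 1 else Real.sqrt 2

/-- `ε₀ = 1`. [cite: Groskin2026, §2.1 (p. 3)] -/
@[simp] theorem evenWeight_zero : evenWeight 0 = 1 := by simp [evenWeight]

/-- `ε_{k+1} = √2`. [cite: Groskin2026, §2.1 (p. 3)] -/
@[simp] theorem evenWeight_succ (k : ℕ) : evenWeight (k + 1) = Real.sqrt 2 := by simp [evenWeight]

/-- The even moments `M_{2j}(v) := Σ_{k=0}^{N} ε_k k^{2j} v_k` (`0⁰ = 1`), i.e. `M₀(v) = v₀ + √2 Σ_{k=1}^{N} v_k`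
and `M_{2j}(v) = √2 Σ_{k=1}^{N} k^{2j} v_k` for `j ≥ 1` ([Gr26] Cor. 2.7; `evenMoment_zero`,
`evenMoment_of_ne_zero`). [cite: Groskin2026, Corollary 2.7 (p. 7)] -/
def evenMoment (N j : ℕ) (v : Fin (N + 1) → ℝ) : ℝ :=
  ∑ k : Fin (N + 1), evenWeight k * ((k : ℕ) : ℝ) ^ (2 * j) * v k

/-- `M₀(v) = v₀ + √2 Σ_{k=1}^{N} v_k`, as printed. [cite: Groskin2026, Corollary 2.7 (p. 7)] -/
theorem evenMoment_zero (N : ℕ) (v : Fin (N + 1) → ℝ) :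
    evenMoment N 0 v = v 0 + Real.sqrt 2 * ∑ k : Fin N, v k.succ := by
  rw [evenMoment, Fin.sum_univ_succ, Finset.mul_sum]
  simp

/-- `M_{2j}(v) = √2 Σ_{k=1}^{N} k^{2j} v_k` for `j ≥ 1`, as printed. [cite: Groskin2026, Corollary 2.7 (p. 7)] -/
theorem evenMoment_of_ne_zero (N : ℕ) {j : ℕ} (hj : j ≠ 0) (v : Fin (N + 1) → ℝ) :
    evenMoment N j v = Real.sqrt 2 * ∑ k : Fin N, (((k : ℕ) + 1 : ℕ) : ℝ) ^ (2 * j) * v k.succ := by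
  rw [evenMoment, Fin.sum_univ_succ, Finset.mul_sum]
  simp [hj, mul_assoc]

/-- `M_{2j}` as a linear functional on `ℝ^{N+1}`. [cite: Groskin2026, Corollary 2.7 (p. 7)] -/
def evenMomentLM (N j : ℕ) : (Fin (N + 1) → ℝ) →ₗ[ℝ] ℝ where
  toFun := evenMoment N j
  map_add' v w := by
    simp only [evenMoment, Pi.add_apply, mul_add, Finset.sum_add_distrib]
  map_smul' a v := by
    simp only [evenMoment, Pi.smul_apply, smul_eq_mul, RingHom.id_apply, Finset.mul_sum]
    exact Finset.sum_congr rfl fun k _ ↦ by ring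

/-- Unfolding of `evenMomentLM`. [cite: Groskin2026, Corollary 2.7 (p. 7)] -/
@[simp] theorem evenMomentLM_apply (N j : ℕ) (v : Fin (N + 1) → ℝ) :
    evenMomentLM N j v = evenMoment N j v := rfl

/-- `H_s(N) := {v : M₀(v) = M₂(v) = ⋯ = M_{2s}(v) = 0}` (`s ≥ 0`), a subspace of `ℝ^{N+1}`
([Gr26] Cor. 2.7). [cite: Groskin2026, Corollary 2.7 (p. 7)] -/
def momentNeutral (N s : ℕ) : Submodule ℝ (Fin (N + 1) → ℝ) :=
  ⨅ j : Fin (s + 1), LinearMap.ker (evenMomentLM N j)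

/-- Membership in `H_s(N)`, as printed. [cite: Groskin2026, Corollary 2.7 (p. 7)] -/
theorem mem_momentNeutral {N s : ℕ} {v : Fin (N + 1) → ℝ} :
    v ∈ momentNeutral N s ↔ ∀ j ≤ s, evenMoment N j v = 0 := by
  simp only [momentNeutral, Submodule.mem_iInf, LinearMap.mem_ker, evenMomentLM_apply]
  constructor
  · intro h j hj
    exact h ⟨j, Nat.lt_succ_of_le hj⟩
  · intro h j
    exact h j (Nat.le_of_lt_succ j.2)

/-- The pole row `v ↦ Σ_{k=0}^{N} ε_k v_k/(k² + β²) = v₀/β² + √2 Σ_{k=1}^{N} v_k/(k² + β²)` defining `P_N(c)`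
([Gr26] Cor. 2.7; printed form: `poleRow_eq`). [cite: Groskin2026, Corollary 2.7 (p. 7)] -/
def poleRow (c : ℝ) (N : ℕ) (v : Fin (N + 1) → ℝ) : ℝ :=
  ∑ k : Fin (N + 1), evenWeight k * v k / ((((k : ℕ) : ℕ) : ℝ) ^ 2 + poleBeta c ^ 2)

/-- `poleRow c N v = v₀/β² + √2 Σ_{k=1}^{N} v_k/(k² + β²)`, as printed. [cite: Groskin2026, Corollary 2.7 (p. 7)] -/
theorem poleRow_eq (c : ℝ) (N : ℕ) (v : Fin (N + 1) → ℝ) :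
    poleRow c N v = v 0 / poleBeta c ^ 2 +
      Real.sqrt 2 * ∑ k : Fin N, v k.succ / ((((k : ℕ) + 1 : ℕ) : ℝ) ^ 2 + poleBeta c ^ 2) := by
  rw [poleRow, Fin.sum_univ_succ, Finset.mul_sum]
  simp [mul_div_assoc]

/-- The pole row as a linear functional on `ℝ^{N+1}`. [cite: Groskin2026, Corollary 2.7 (p. 7)] -/
def poleRowLM (c : ℝ) (N : ℕ) : (Fin (N + 1) → ℝ) →ₗ[ℝ] ℝ where
  toFun := poleRow c N
  map_add' v w := by
    simp only [poleRow, Pi.add_apply, mul_add, add_div, Finset.sum_add_distrib]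
  map_smul' a v := by
    simp only [poleRow, Pi.smul_apply, smul_eq_mul, RingHom.id_apply, Finset.mul_sum]
    exact Finset.sum_congr rfl fun k _ ↦ by ring

/-- Unfolding of `poleRowLM`. [cite: Groskin2026, Corollary 2.7 (p. 7)] -/
@[simp] theorem poleRowLM_apply (c : ℝ) (N : ℕ) (v : Fin (N + 1) → ℝ) :
    poleRowLM c N v = poleRow c N v := rfl

/-- The pole-neutral hyperplane `P_N(c) := {v : v₀/β² + √2 Σ_{k=1}^{N} v_k/(k² + β²) = 0}` ([Gr26] Cor. 2.7;
"`P_N(c)` is exactly the pole-neutral row"). [cite: Groskin2026, Corollary 2.7 (p. 7)] -/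
def poleNeutral (c : ℝ) (N : ℕ) : Submodule ℝ (Fin (N + 1) → ℝ) := LinearMap.ker (poleRowLM c N)

/-- Membership in `P_N(c)`, as printed. [cite: Groskin2026, Corollary 2.7 (p. 7)] -/
theorem mem_poleNeutral {c : ℝ} {N : ℕ} {v : Fin (N + 1) → ℝ} :
    v ∈ poleNeutral c N ↔ poleRow c N v = 0 := LinearMap.mem_ker

/-- **[Gr26] Corollary 2.7 (pole-neutral source survival)** (p. 7), AS PRINTED: for `c > 1` and
`N ≥ s + 2`, (a) `dim(H_s(N) ∩ P_N(c)) = N − s − 1` (`> 0`); (b) every nonzero `v ∈ H_s(N) ∩ P_N(c)` gives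
a nonzero test function `g_v` with `g_v(i/2) = 0` (so "on this family the dictionary of Theorem 2.5 has
no pole term"); (c) `g_v = g_w` implies `v = w` or `v = −w` (typed for all real `v, w`: the printed proof,
p. 8 — "`K_v = 2(T_v ∗ T_v)` in the Volterra convolution algebra of analytic germs at `0` … an integral
domain … `T_v = ±T_w` and `v = ±w`" — uses no membership). The displayed pole-square identity of the proof
is PROVED below (`quadValue_poleMatrix_eq_sq`), and with cc-t9's `quadValue_poleMatrix` (`⟨v, Q_pole v⟩ = 2g_v(i/2)`,
`TruncatedWeilFormSourceSideProofs.lean`) so is the part "`g_v(i/2) = 0` on `P_N(c)`" of (b)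
(`testFunction_I_half_eq_zero_of_mem_poleNeutral`). CLAIM. [claim: Groskin2026, status: under-review] -/
def corollary_2_7 : Prop :=
  ∀ (c : ℝ), 1 < c → ∀ (N s : ℕ), s + 2 ≤ N →
    Module.finrank ℝ ↥(momentNeutral N s ⊓ poleNeutral c N) = N - s - 1 ∧
    (∀ v ∈ momentNeutral N s ⊓ poleNeutral c N, v ≠ 0 →
        testFunction c N v ≠ 0 ∧ testFunction c N v (Complex.I / 2) = 0) ∧
    ∀ v w : Fin (N + 1) → ℝ, testFunction c N v = testFunction c N w → v = w ∨ v = -w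

/-! ### Sums over `I_N` against the even embedding -/

/-- The reflection `m ↦ −m` of `I_N`. [cite: Groskin2026, §2.1 (p. 3)] -/
def negIdx (N : ℕ) : idx N ≃ idx N where
  toFun m := ⟨-(m : ℤ), by have h := m.2; simp only [idx, Finset.mem_Icc] at h ⊢; omega⟩
  invFun m := ⟨-(m : ℤ), by have h := m.2; simp only [idx, Finset.mem_Icc] at h ⊢; omega⟩
  left_inv m := by ext; simp
  right_inv m := by ext; simp

/-- `(negIdx m : ℤ) = −m`. [cite: Groskin2026, §2.1 (p. 3)] -/
@[simp] theorem coe_negIdx (N : ℕ) (m : idx N) : ((negIdx N m : idx N) : ℤ) = -(m : ℤ) := rfl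

/-- The even embedding is even: `u_{−m} = u_m`. [cite: Groskin2026, §2.1 (p. 3)] -/
theorem evenEmbed_negIdx (N : ℕ) (v : Fin (N + 1) → ℝ) (m : idx N) :
    evenEmbed N v (negIdx N m) = evenEmbed N v m := by
  simp only [evenEmbed, coe_negIdx, neg_eq_zero, Int.natAbs_neg]

/-- An odd function sums to zero over `I_N` (the "by symmetry" step of the proof of Cor. 2.7, p. 7).
[cite: Groskin2026, Corollary 2.7, proof (p. 7)] -/
theorem sum_idx_eq_zero_of_odd {N : ℕ} {f : idx N → ℝ} (hf : ∀ m, f (negIdx N m) = -f m) :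
    ∑ m, f m = 0 := by
  have h := Equiv.sum_comp (negIdx N) f
  simp only [hf, Finset.sum_neg_distrib] at h
  linarith

/-- `0 ∈ I_N`. [cite: Groskin2026, §2.1 (p. 3)] -/
theorem zero_mem_idx (N : ℕ) : (0 : ℤ) ∈ idx N := by simp [idx]

/-- `k + 1 ∈ I_N` for `k < N`. [cite: Groskin2026, §2.1 (p. 3)] -/
theorem succ_mem_idx {N : ℕ} (k : Fin N) : (((k : ℕ) + 1 : ℕ) : ℤ) ∈ idx N := by
  have := k.2; simp only [idx, Finset.mem_Icc]; omega

/-- `−(k + 1) ∈ I_N` for `k < N`. [cite: Groskin2026, §2.1 (p. 3)] -/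
theorem neg_succ_mem_idx {N : ℕ} (k : Fin N) : -((((k : ℕ) + 1 : ℕ) : ℤ)) ∈ idx N := by
  have := k.2; simp only [idx, Finset.mem_Icc]; omega

/-- `Σ_{z=−N}^{N} F(z) = F(0) + Σ_{k=0}^{N−1} (F(k+1) + F(−(k+1)))`. [folklore] -/
private theorem sum_Icc_neg_eq (N : ℕ) (F : ℤ → ℝ) :
    ∑ z ∈ Finset.Icc (-(N : ℤ)) N, F z =
      F 0 + ∑ k ∈ Finset.range N, (F (((k + 1 : ℕ) : ℤ)) + F (-((k + 1 : ℕ) : ℤ))) := by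
  induction N with
  | zero => simp
  | succ N ih =>
    have hset : Finset.Icc (-((N + 1 : ℕ) : ℤ)) ((N + 1 : ℕ) : ℤ) =
        insert (-((N + 1 : ℕ) : ℤ)) (insert (((N + 1 : ℕ) : ℤ)) (Finset.Icc (-(N : ℤ)) N)) := by
      ext z
      simp only [Finset.mem_Icc, Finset.mem_insert]
      push_cast
      omega
    have h1 : (-((N + 1 : ℕ) : ℤ)) ∉ insert (((N + 1 : ℕ) : ℤ)) (Finset.Icc (-(N : ℤ)) N) := by
      simp only [Finset.mem_insert, Finset.mem_Icc]; push_cast; omega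
    have h2 : (((N + 1 : ℕ) : ℤ)) ∉ Finset.Icc (-(N : ℤ)) (N : ℤ) := by
      simp only [Finset.mem_Icc]; push_cast; omega
    rw [hset, Finset.sum_insert h1, Finset.sum_insert h2, ih, Finset.sum_range_succ]
    ring

/-- The same decomposition for a function on the index type `I_N`:
`Σ_{m ∈ I_N} f(m) = f(0) + Σ_{k<N} (f(k+1) + f(−(k+1)))` (bookkeeping for the index set `I_N` of §2.1).
[cite: Groskin2026, §2.1 (p. 3)] -/
theorem sum_idx_split {N : ℕ} (f : idx N → ℝ) :
    ∑ m, f m = f ⟨0, zero_mem_idx N⟩ +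
      ∑ k : Fin N, (f ⟨_, succ_mem_idx k⟩ + f ⟨_, neg_succ_mem_idx k⟩) := by
  classical
  set F : ℤ → ℝ := fun z ↦ if h : z ∈ idx N then f ⟨z, h⟩ else 0 with hF
  have h1 : ∑ m, f m = ∑ z ∈ idx N, F z := by
    rw [← Finset.sum_coe_sort (idx N)]
    refine Finset.sum_congr rfl fun m _ ↦ ?_
    rw [hF]; simp only [dif_pos m.2]
  have h2 : ∑ z ∈ idx N, F z =
      F 0 + ∑ k ∈ Finset.range N, (F (((k + 1 : ℕ) : ℤ)) + F (-((k + 1 : ℕ) : ℤ))) :=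
    sum_Icc_neg_eq N F
  rw [h1, h2, Finset.sum_range]
  congr 1
  · rw [hF]; simp only [dif_pos (zero_mem_idx N)]
  · refine Finset.sum_congr rfl fun k _ ↦ ?_
    rw [hF]
    simp only [dif_pos (succ_mem_idx k), dif_pos (neg_succ_mem_idx k)]

/-- `u₀ = v₀`. [cite: Groskin2026, §2.1 (p. 3)] -/
theorem evenEmbed_zero' (N : ℕ) (v : Fin (N + 1) → ℝ) :
    evenEmbed N v ⟨0, zero_mem_idx N⟩ = v 0 := by
  simp [evenEmbed]

/-- `u_{k+1} = v_{k+1}/√2`. [cite: Groskin2026, §2.1 (p. 3)] -/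
theorem evenEmbed_succ' {N : ℕ} (v : Fin (N + 1) → ℝ) (k : Fin N) :
    evenEmbed N v ⟨_, succ_mem_idx k⟩ = v k.succ / Real.sqrt 2 := by
  simp only [evenEmbed]
  rw [if_neg (by push_cast; omega)]
  congr 2

/-- `u_{−(k+1)} = v_{k+1}/√2`. [cite: Groskin2026, §2.1 (p. 3)] -/
theorem evenEmbed_neg_succ' {N : ℕ} (v : Fin (N + 1) → ℝ) (k : Fin N) :
    evenEmbed N v ⟨_, neg_succ_mem_idx k⟩ = v k.succ / Real.sqrt 2 := by
  simp only [evenEmbed]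
  rw [if_neg (by push_cast; omega)]
  congr 2

/-- `Σ_{m ∈ I_N} u_m g(m) = Σ_{k=0}^{N} ε_k v_k g(k)` for every even weight `g` (the isometry of §2.1
against an even vector: `2 · (v_k/√2) = √2 v_k`). [cite: Groskin2026, §2.1 (p. 3) and Corollary 2.7, proof (p. 7)] -/
theorem sum_evenEmbed_mul_even {N : ℕ} (v : Fin (N + 1) → ℝ) (g : ℤ → ℝ) (hg : ∀ z, g (-z) = g z) :
    ∑ m : idx N, evenEmbed N v m * g m = ∑ k : Fin (N + 1), evenWeight k * v k * g ((k : ℕ) : ℤ) := by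
  rw [sum_idx_split, Fin.sum_univ_succ]
  simp only [evenEmbed_zero', evenEmbed_succ', evenEmbed_neg_succ', hg, Fin.val_zero,
    evenWeight_zero, one_mul, Fin.val_succ, evenWeight_succ, Nat.cast_zero]
  congr 1
  refine Finset.sum_congr rfl fun k _ ↦ ?_
  have h2 : Real.sqrt 2 ≠ 0 := by positivity
  have h22 : Real.sqrt 2 ^ 2 = 2 := Real.sq_sqrt (by norm_num)
  field_simp
  linear_combination (-(v k.succ * g (((k : ℕ) + 1 : ℕ) : ℤ))) * h22

/-- `Σ_{m ∈ I_N} u_m/(m² + β²) = v₀/β² + √2 Σ_{k=1}^{N} v_k/(k² + β²)` (the pole row). PROVED.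
[cite: Groskin2026, Corollary 2.7, proof (p. 7)] -/
theorem sum_evenEmbed_div (c : ℝ) (N : ℕ) (v : Fin (N + 1) → ℝ) :
    ∑ m : idx N, evenEmbed N v m / (((m : ℤ) : ℝ) ^ 2 + poleBeta c ^ 2) = poleRow c N v := by
  have h := sum_evenEmbed_mul_even v (fun z ↦ 1 / (((z : ℤ) : ℝ) ^ 2 + poleBeta c ^ 2))
    (fun z ↦ by push_cast; rw [neg_sq])
  simp only [mul_one_div] at h
  rw [h, poleRow]
  refine Finset.sum_congr rfl fun k _ ↦ ?_
  push_cast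
  ring

/-- "using `Σ_m u_m m/(m² + β²) = 0` by symmetry" (p. 7). PROVED. [cite: Groskin2026, Corollary 2.7, proof (p. 7)] -/
theorem sum_evenEmbed_mul_div (c : ℝ) (N : ℕ) (v : Fin (N + 1) → ℝ) :
    ∑ m : idx N, evenEmbed N v m * ((m : ℤ) : ℝ) / (((m : ℤ) : ℝ) ^ 2 + poleBeta c ^ 2) = 0 := by
  refine sum_idx_eq_zero_of_odd fun m ↦ ?_
  rw [evenEmbed_negIdx, coe_negIdx]
  push_cast
  rw [neg_sq]
  ring

/-- **The pole-square identity of the proof of Cor. 2.7 — PROVED:** "contracting against the even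
embedding, and using `Σ_m u_m m/(m² + β²) = 0` by symmetry,
`⟨v, Q_pole v⟩ = C_c β² (v₀/β² + √2 Σ_{k=1}^{N} v_k/(k² + β²))²`" (p. 7). (The further printed equality
`= 2 g_v(i/2)` is the pole clause of Theorem 2.5 and is not proved here.)
[cite: Groskin2026, Corollary 2.7, proof (p. 7)] -/
theorem quadValue_poleMatrix_eq_sq {c : ℝ} (hc : 1 < c) (N : ℕ) (v : Fin (N + 1) → ℝ) :
    quadValue N v (poleMatrix c N) = poleConst c * poleBeta c ^ 2 * poleRow c N v ^ 2 := by
  have hβ := poleBeta_pos hc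
  set u := evenEmbed N v with hu
  set a : idx N → ℝ := fun m ↦ 1 / (((m : ℤ) : ℝ) ^ 2 + poleBeta c ^ 2) with ha
  set b : idx N → ℝ := fun m ↦ ((m : ℤ) : ℝ) / (((m : ℤ) : ℝ) ^ 2 + poleBeta c ^ 2) with hb
  have hentry : ∀ m n : idx N, poleMatrix c N m n =
      poleConst c * (poleBeta c ^ 2 * (a m * a n) - b m * b n) := by
    intro m n
    rw [poleMatrix_eq_poleConst hc, ha, hb]
    have hDm : (((m : ℤ) : ℝ) ^ 2 + poleBeta c ^ 2) ≠ 0 := by positivity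
    have hDn : (((n : ℤ) : ℝ) ^ 2 + poleBeta c ^ 2) ≠ 0 := by positivity
    field_simp
  have hA : ∑ m, u m * a m = poleRow c N v := by
    rw [← sum_evenEmbed_div c N v]
    exact Finset.sum_congr rfl fun m _ ↦ by rw [ha]; ring
  have hB : ∑ m, u m * b m = 0 := by
    rw [← sum_evenEmbed_mul_div c N v]
    exact Finset.sum_congr rfl fun m _ ↦ by rw [hb]; ring
  rw [quadValue_eq_sum']
  calc ∑ m, ∑ n, u m * u n * poleMatrix c N m n
      = ∑ m, ∑ n, (poleConst c * poleBeta c ^ 2 * ((u m * a m) * (u n * a n)) -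
          poleConst c * ((u m * b m) * (u n * b n))) := by
        refine Finset.sum_congr rfl fun m _ ↦ Finset.sum_congr rfl fun n _ ↦ ?_
        rw [hentry]; ring
    _ = poleConst c * poleBeta c ^ 2 * ((∑ m, u m * a m) * (∑ n, u n * a n)) -
          poleConst c * ((∑ m, u m * b m) * (∑ n, u n * b n)) := by
        rw [Finset.sum_mul_sum, Finset.sum_mul_sum, Finset.mul_sum, Finset.mul_sum,
          ← Finset.sum_sub_distrib]
        refine Finset.sum_congr rfl fun m _ ↦ ?_
        rw [Finset.mul_sum, Finset.mul_sum, ← Finset.sum_sub_distrib]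
    _ = poleConst c * poleBeta c ^ 2 * poleRow c N v ^ 2 := by rw [hA, hB]; ring

/-- "On this family the dictionary of Theorem 2.5 has no pole term", at the level of the matrix:
for `v ∈ P_N(c)`, `⟨v, Q_pole v⟩ = 0`. PROVED. [cite: Groskin2026, Corollary 2.7 (p. 7)] -/
theorem quadValue_poleMatrix_eq_zero_of_mem_poleNeutral {c : ℝ} (hc : 1 < c) {N : ℕ}
    {v : Fin (N + 1) → ℝ} (hv : v ∈ poleNeutral c N) : quadValue N v (poleMatrix c N) = 0 := by
  rw [quadValue_poleMatrix_eq_sq hc, mem_poleNeutral.mp hv]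
  ring

/-- Conversely `⟨v, Q_pole v⟩ = 0` only on `P_N(c)` (`C_c β² > 0`): the pole-neutral hyperplane is
exactly the null cone of the (rank-one, positive semidefinite) pole form on the even sector. PROVED.
[cite: Groskin2026, Corollary 2.7, proof (p. 7–8: "`P_N(c)` is exactly the pole-neutral row")] -/
theorem mem_poleNeutral_iff_quadValue_poleMatrix_eq_zero {c : ℝ} (hc : 1 < c) {N : ℕ}
    {v : Fin (N + 1) → ℝ} : v ∈ poleNeutral c N ↔ quadValue N v (poleMatrix c N) = 0 := by
  rw [quadValue_poleMatrix_eq_sq hc, mem_poleNeutral]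
  have h : 0 < poleConst c * poleBeta c ^ 2 := mul_pos (poleConst_pos hc) (pow_pos (poleBeta_pos hc) 2)
  constructor
  · intro hv; rw [hv]; ring
  · intro hv
    have := (mul_eq_zero.mp hv).resolve_left h.ne'
    exact pow_eq_zero_iff (n := 2) (by norm_num) |>.mp this


/-- **The full display of the proof of Cor. 2.7 — PROVED:**
`2 g_v(i/2) = ⟨v, Q_pole v⟩ = C_c β² (v₀/β² + √2 Σ_{k=1}^{N} v_k/(k² + β²))²` (p. 7), combining
`quadValue_poleMatrix_eq_sq` with the pole side of Theorem 2.5 (`quadValue_poleMatrix`, PROVED by seat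
cc-t9 in `TruncatedWeilFormSourceSideProofs.lean`). [cite: Groskin2026, Corollary 2.7, proof (p. 7)] -/
theorem two_mul_testFunction_I_half_eq_sq {c : ℝ} (hc : 1 < c) (N : ℕ) (v : Fin (N + 1) → ℝ) :
    2 * testFunction c N v (Complex.I / 2) =
      ((poleConst c * poleBeta c ^ 2 * poleRow c N v ^ 2 : ℝ) : ℂ) := by
  rw [← quadValue_poleMatrix c hc N v, quadValue_poleMatrix_eq_sq hc]

/-- **[Gr26] Cor. 2.7 (b), the clause "`g_v(i/2) = 0`" — PROVED:** every `v ∈ P_N(c)` has `g_v(i/2) = 0`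
("on this family the dictionary of Theorem 2.5 has no pole term"). [cite: Groskin2026, Corollary 2.7 (p. 7)] -/
theorem testFunction_I_half_eq_zero_of_mem_poleNeutral {c : ℝ} (hc : 1 < c) {N : ℕ}
    {v : Fin (N + 1) → ℝ} (hv : v ∈ poleNeutral c N) : testFunction c N v (Complex.I / 2) = 0 := by
  have h := two_mul_testFunction_I_half_eq_sq hc N v
  rw [mem_poleNeutral.mp hv] at h
  simp only [ne_eq, OfNat.ofNat_ne_zero, not_false_eq_true, zero_pow, mul_zero,
    Complex.ofReal_zero, mul_eq_zero, OfNat.ofNat_ne_zero, false_or] at h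
  exact h

/-- Conversely, `g_v(i/2) = 0` only on `P_N(c)`: the pole-neutral hyperplane is exactly the set of real
vectors whose test function has no pole term. PROVED. [cite: Groskin2026, Corollary 2.7 (p. 7–8)] -/
theorem mem_poleNeutral_iff_testFunction_I_half_eq_zero {c : ℝ} (hc : 1 < c) {N : ℕ}
    {v : Fin (N + 1) → ℝ} : v ∈ poleNeutral c N ↔ testFunction c N v (Complex.I / 2) = 0 := by
  refine ⟨testFunction_I_half_eq_zero_of_mem_poleNeutral hc, fun h ↦ ?_⟩
  rw [mem_poleNeutral_iff_quadValue_poleMatrix_eq_zero hc]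
  have h2 := quadValue_poleMatrix c hc N v
  rw [h, mul_zero] at h2
  exact_mod_cast h2

end Groskin2026

end Literature.NumberTheory.LFunctions

end
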